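import Summits.BirchSwinnertonDyer.Rank1Residual.X2.CpIntSeriesCongruenceLimit
import Literature.NumberTheory.EllipticCurves.SigmaEulerData
import Summits.BirchSwinnertonDyer.BirchSwinnertonDyer.Theorems.ErratumRoadFiveSigmaEulerFactorFirstUnitCoeff
import Summits.BirchSwinnertonDyer.BirchSwinnertonDyer.Theorems.EisensteinPrimesNumPlacesAboveRepresentatives
import Summits.BirchSwinnertonDyer.BirchSwinnertonDyer.Theorems.UniversalToricDescentSigmaEulerMuZero
import Summits.BirchSwinnertonDyer.BirchSwinnertonDyer.Theorems.ErratumRoadFiveIMCDivRoadFFSigmaDataBNoDefect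
import Summits.BirchSwinnertonDyer.Rank1Residual.X11b.RouteR1IntReceptacle
import Literature.NumberTheory.EllipticCurves.KellerYin2024.AnticyclotomicLocalEulerFactors
import Literature.NumberTheory.EllipticCurves.HasseWeilAbelianBadReduction
import Literature.NumberTheory.EllipticCurves.HasseWeilGoodReductionFrobenius
import Literature.NumberTheory.GaloisCohomology.CyclotomicCharacterPPrimary
import Literature.NumberTheory.GaloisRepresentations.LocalFrobeniusDensity
import HarnessLib

/-!
# Line «crystal» of crux 4 `BSDpOnCellC` (stmt-BirchSwinnertonDyer-19034), §L.1–§L.3 as TREE THEOREMS: the Σ-Euler factor of `E/K` at ONE place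
# of `Σ` has its first unit coefficient EXACTLY at Keller–Yin's `curveLocalLambda κ (E/K) w` in `𝓞_{ℂ_p}⟦T⟧`
# (cell `bsd-eis`; mathematics and Lean text by ideator bsd-idea-12 g14, `Cruxes/BSDpOnCellC/Lines/crystal.lean` v3 §L, sorry-free there since
# 2026-08-28T23:2xZ; landed under `Theorems/` by the LEAD cruxlead-19034 g0 so that it is importable — the registered skeleton carried it in-file;
# `--supports stmt-BirchSwinnertonDyer-19034`; namespace moved `…Cruxes.BSDpOnCellC.Crystal.LambdaSigma` ↦ `…Theorems.CrystalLambdaSigma`, text otherwise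
# VERBATIM)

HONEST FRAMING (run/shared/lean/pub/bsd-eis/): kernel theorems about the tree's DEFINITIONS `SigmaEulerFactors.eulerFactor` / `curveLocalLambda` /
`numPlacesAbove` (pure local algebra + Frobenius density); 0 defs, 0 named facts, 0 sorry; nothing about any `p`-adic `L`-function, Selmer group,
main conjecture or BSD is asserted or proved; 0 cells / labels / tiers move. Companion `…CrystalLambdaSigma.lean` (§L.4) assembles the product:
`λ(P_Σ(E/K)) = Σ_{w∈Σ} curveLocalLambda κ (E/K) w` — conjunct (II) of line «crystal», consumed by the registered skeleton's `han_of_…` /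
`hanSplitLight_of_…` (the [AN-mult] / [AN-split] transports).

CONTENT. §L.1 `κ(D_w) = p^{v_p(c_w)}ℤ_p` at `w ∤ p` with `c_w = κ.frobExponentAt w ≠ 0` (Frobenius density on `D_w`:
`exists_forall_smul_eq_pow_and_mem`, `apply_localMap_inr`) ⟹ `numPlacesAbove κ w = p^{v_p(c_w)}` (`NumPlacesAboveRepresentatives.numPlacesAbove_eq_pow_valuation`);
§L.2 root multiplicities `ord_{Y=1} Q̄_w = ord_{X=N(w)⁻¹} P̄_w` for the four reduction types (Mathlib `localPolynomialAt_of_*`, `rootMultiplicity`);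
§L.3 ONE place: `firstUnitCoeffAt_eulerFactor_sigmaPlace` — the tree's `SigmaFactorFU.firstUnitCoeffAt_aeval_binomialSeries_map` (x11b-p20:
`Q((1+T)^{p^s b'})` has its first unit coefficient at `p^s · ord_{Y=1} Q̄`) + Gauss + the isometry `ℤ_p → R₀`.

References: [GreenbergVatsal2000] §2 Prop. (2.4) (p. 22: `d_ℓ` = multiplicity of `X = ℓ̃⁻¹` as a root of `P̃_ℓ`); [KellerYin2024] §1.5 and Lemma 1.1.1
(arXiv:2402.12781v2); [CastellaGrossiLeeSkinner2022] Thm. 2.2.2 (the term `λ(𝒫_w(E))`); [Washington1997] §7.1 Prop. 7.2; cell: `Lines/crystal.md` r3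
(critic V89 note N1: «prove (II) first» — done), `Lines/crystal.lean` v3–v7 §L.
-/

set_option autoImplicit false
set_option linter.dupNamespace false

noncomputable section

namespace Summit.BirchSwinnertonDyer.BirchSwinnertonDyer.Theorems.CrystalLambdaSigma

open scoped Classical

open WeierstrassCurve NumberField IsDedekindDomain Field
open Literature.NumberTheory.EllipticCurves Literature.NumberTheory.EllipticCurves.GreenbergSelmer
  Literature.NumberTheory.EllipticCurves.IwasawaCharacter
  Literature.NumberTheory.EllipticCurves.BigGaloisRep
  Literature.NumberTheory.EllipticCurves.JetchevSkinnerWan2017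
  Literature.NumberTheory.GaloisRepresentations
  Literature.NumberTheory.EllipticCurves.KellerYin2024
open Summit.BirchSwinnertonDyer.Rank1Residual.X11b.Halves
  Summit.BirchSwinnertonDyer.Rank1Residual.X1.KellerYinHalves
  Summit.BirchSwinnertonDyer.Rank1Residual.X11b
  Summit.BirchSwinnertonDyer.BirchSwinnertonDyer.Theorems

/-! ### §L.1 `κ(D_w) = p^{v(c_w)} ℤ_p`: `numPlacesAbove κ w = p ^ v_p(c_w)` at `w ∤ p` with `c_w ≠ 0` -/

section Decomp

variable {K : Type} [Field K] [NumberField K] {p : ℕ} [Fact p.Prime] (κ : ZpExtension K p)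

/-- **Every value of `κ` on `D_w` is divisible by `p^{v_p(c_w)}`** (`w ∤ p`): `κ ∘ res_w` kills `I_w`
(`apply_localMap_inr`) and takes the value `c_w` at an arithmetic Frobenius `φ_w`; `⟨φ_w⟩·I_w` is dense in `Γ_{K_w}`
(`exists_forall_smul_eq_pow_and_mem` on the open preimage of the layer `κ⁻¹(p^n ℤ_p)`, `n = v_p(c_w)`), so
`κ(res_w σ) ≡ a·c_w (mod p^n)` for some `a ∈ ℕ`. [cite: SerreLocalFields1979, Ch. IV §4 Cor. 2 to Prop. 16]
[cite: Washington1997, Prop. 13.2] -/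
theorem pow_valuation_frobExponentAt_dvd {w : HeightOneSpectrum (𝓞 K)}
    (hw : ((p : ℕ) : 𝓞 K) ∉ w.asIdeal) {δ : absoluteGaloisGroup K} (hδ : δ ∈ decomp (K := K) w) :
    (p : ℤ_[p]) ^ (κ.frobExponentAt w).valuation ∣ (κ δ).toAdd := by
  obtain ⟨σ, rfl⟩ := hδ
  obtain ⟨φ, hφ, hκφ⟩ := κ.exists_isFrobPow_apply_localMap_eq w
  have hφa : IsAbsArithFrob φ := isFrobPow_one_iff_isAbsArithFrob_holds.mp hφ
  set res := absGaloisRestrict K (w.adicCompletion K) with hres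
  set c : ℤ_[p] := κ.frobExponentAt w with hc
  set n : ℕ := c.valuation with hn
  change (p : ℤ_[p]) ^ n ∣ (κ (res σ)).toAdd
  have hφ1 : κ (res φ) = Multiplicative.ofAdd c := hκφ
  have hU : IsOpen (res ⁻¹' (κ.layerSubgroup n : Set (absoluteGaloisGroup K))) :=
    (κ.isOpen_layerSubgroup n).preimage res.continuous
  have hIU : (absInertia (w.adicCompletion K) : Set _) ⊆
      res ⁻¹' (κ.layerSubgroup n : Set (absoluteGaloisGroup K)) := by
    intro i hi
    show res i ∈ κ.layerSubgroup n
    have h1 : κ (res i) = 1 := κ.apply_localMap_inr hw ⟨i, hi⟩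
    rw [ZpExtension.mem_layerSubgroup, h1, toAdd_one]
    exact dvd_zero _
  obtain ⟨a, -, ha⟩ :=
    IsNonarchimedeanLocalField.exists_forall_smul_eq_pow_and_mem hφa σ ∅ (by simp) hU hIU
  have ha' : res ((φ ^ a)⁻¹ * σ) ∈ κ.layerSubgroup n := ha
  rw [ZpExtension.mem_layerSubgroup, map_mul, map_inv, map_pow, map_mul, map_inv, map_pow, hφ1,
    toAdd_mul, toAdd_inv, toAdd_pow, toAdd_ofAdd] at ha'
  have hcn : (p : ℤ_[p]) ^ n ∣ c := by
    by_cases hc0 : c = 0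
    · rw [hc0]; exact dvd_zero _
    · exact ⟨(PadicInt.unitCoeff hc0 : ℤ_[p]), by rw [hn, mul_comm]; exact PadicInt.unitCoeff_spec hc0⟩
  have hac : (p : ℤ_[p]) ^ n ∣ -(a • c) := by
    rw [dvd_neg, nsmul_eq_mul]
    exact hcn.mul_left _
  exact (dvd_add_right hac).mp ha'

/-- **`numPlacesAbove κ w = p^{v_p(c_w)}`** for `w ∤ p` with `c_w ≠ 0`: the image `κ(D_w)` is `p^{v_p(c_w)} ℤ_p`
(it contains `c_w = κ(φ_w)` and is contained in `p^{v_p(c_w)} ℤ_p` by `pow_valuation_frobExponentAt_dvd`), whose index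
is `p^{v_p(c_w)}` (`numPlacesAbove_eq_pow_valuation`). This is GV's `s_ℓ`/KY's `[Γ : Γ_w]` read off the Frobenius
exponent. [cite: GreenbergVatsal2000, §2 p. 21] [cite: KellerYin2024, Lemma 1.1.1 (arXiv:2402.12781v2 TeX L455–462)] -/
theorem numPlacesAbove_eq_pow_valuation_frobExponentAt {w : HeightOneSpectrum (𝓞 K)}
    (hw : ((p : ℕ) : 𝓞 K) ∉ w.asIdeal) (hc : κ.frobExponentAt w ≠ 0) :
    numPlacesAbove κ w = p ^ (κ.frobExponentAt w).valuation := by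
  obtain ⟨φ, hφ, hκφ⟩ := κ.exists_isFrobPow_apply_localMap_eq w
  set δ₁ : absoluteGaloisGroup K := absGaloisRestrict K (w.adicCompletion K) φ with hδ₁def
  have hδ₁ : δ₁ ∈ decomp (K := K) w := ⟨φ, rfl⟩
  have hval : (κ δ₁).toAdd = κ.frobExponentAt w := by
    have h : κ δ₁ = Multiplicative.ofAdd (κ.frobExponentAt w) := hκφ
    rw [h, toAdd_ofAdd]
  have hne : κ δ₁ ≠ 1 := fun h ↦ hc (by rw [← hval, h, toAdd_one])
  have hmin : ∀ δ ∈ decomp (K := K) w, κ δ ≠ 1 →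
      ((κ δ₁).toAdd).valuation ≤ ((κ δ).toAdd).valuation := by
    intro δ hδ hδ1
    have hx0 : (κ δ).toAdd ≠ 0 := fun h ↦ hδ1 (by rw [← ofAdd_toAdd (κ δ), h, ofAdd_zero])
    obtain ⟨y, hy⟩ := pow_valuation_frobExponentAt_dvd κ hw hδ
    have hy0 : y ≠ 0 := by
      rintro rfl
      exact hx0 (by rw [hy, mul_zero])
    rw [hval, hy, PadicInt.valuation_p_pow_mul _ _ hy0]
    exact Nat.le_add_right _ _
  rw [NumPlacesAboveRepresentatives.numPlacesAbove_eq_pow_valuation κ w hδ₁ hne hmin, hval]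

end Decomp

/-! ### §L.2 Root multiplicities: `ord_{Y=1} Q̄_w = ord_{X = N(w)⁻¹} P̄_w` for the four reduction types -/

section Roots

open Polynomial

variable {F : Type*} [Field F]

/-- `1 - X = C (-1) * (X - C 1)` has the root multiplicities of `X - C 1`. [folklore] -/
theorem rootMultiplicity_one_sub_X (r : F) :
    (1 - X : F[X]).rootMultiplicity r = if r = 1 then 1 else 0 := by
  have h : (1 - X : F[X]) = C (-1) * (X - C 1) := by simp only [map_neg, map_one]; ring
  have hne : C (-1) * (X - C 1) ≠ (0 : F[X]) := mul_ne_zero (C_ne_zero.mpr (by norm_num)) (X_sub_C_ne_zero 1)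
  rw [h, rootMultiplicity_mul hne, rootMultiplicity_C, zero_add, rootMultiplicity_X_sub_C]

/-- `1 + X = X - C (-1)`. [folklore] -/
theorem rootMultiplicity_one_add_X (r : F) :
    (1 + X : F[X]).rootMultiplicity r = if r = -1 then 1 else 0 := by
  have h : (1 + X : F[X]) = X - C (-1) := by simp only [map_neg, map_one]; ring
  rw [h, rootMultiplicity_X_sub_C]

/-- Split multiplicative type: `ord_{Y=1}(N Y - 1) = ord_{X=N⁻¹}(1 - X)` (both `[N = 1]`). [folklore] -/
theorem rootMultiplicity_split (N : F) :
    (C N * X - 1 : F[X]).rootMultiplicity 1 = (1 - X : F[X]).rootMultiplicity N⁻¹ := by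
  rw [rootMultiplicity_one_sub_X]
  by_cases hN1 : N = 1
  · subst hN1
    rw [inv_one, if_pos rfl, map_one, one_mul, ← map_one C]
    exact rootMultiplicity_X_sub_C_self
  · have hne : N⁻¹ ≠ 1 := fun h ↦ hN1 (by rwa [inv_eq_iff_eq_inv, inv_one] at h)
    rw [if_neg hne]
    refine rootMultiplicity_eq_zero ?_
    simp only [IsRoot.def, eval_sub, eval_mul, eval_C, eval_X, mul_one, eval_one]
    exact sub_ne_zero.mpr hN1

/-- Non-split multiplicative type: `ord_{Y=1}(N Y + 1) = ord_{X=N⁻¹}(1 + X)` (both `[N = -1]`). [folklore] -/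
theorem rootMultiplicity_nonsplit (N : F) :
    (C N * X + 1 : F[X]).rootMultiplicity 1 = (1 + X : F[X]).rootMultiplicity N⁻¹ := by
  rw [rootMultiplicity_one_add_X]
  by_cases hN1 : N = -1
  · subst hN1
    have h : (C (-1 : F) * X + 1 : F[X]) = C (-1) * (X - C 1) := by simp only [map_neg, map_one]; ring
    have hne : C (-1) * (X - C 1) ≠ (0 : F[X]) :=
      mul_ne_zero (C_ne_zero.mpr (by norm_num)) (X_sub_C_ne_zero 1)
    rw [inv_neg, inv_one, if_pos rfl, h, rootMultiplicity_mul hne, rootMultiplicity_C, zero_add]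
    exact rootMultiplicity_X_sub_C_self
  · have hne : N⁻¹ ≠ -1 := fun h ↦ hN1 (by rwa [inv_eq_iff_eq_inv, inv_neg, inv_one] at h)
    rw [if_neg hne]
    refine rootMultiplicity_eq_zero ?_
    simp only [IsRoot.def, eval_add, eval_mul, eval_C, eval_X, mul_one, eval_one]
    exact fun h ↦ hN1 (eq_neg_of_add_eq_zero_left h)

/-- Good type: `ord_{Y=1}(N Y² - a Y + 1) = ord_{X=N⁻¹}(1 - a X + N X²)` for `N ≠ 0` — the same polynomial, and
`X ↦ 1/(N X)` permutes its roots (`1 ↔ N⁻¹` with the same multiplicity). [folklore] -/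
theorem rootMultiplicity_good {N : F} (a : F) (hN : N ≠ 0) :
    (C N * X ^ 2 - C a * X + 1 : F[X]).rootMultiplicity 1 =
      (1 - C a * X + C N * X ^ 2 : F[X]).rootMultiplicity N⁻¹ := by
  have hRR : (1 - C a * X + C N * X ^ 2 : F[X]) = C N * X ^ 2 - C a * X + 1 := by ring
  rw [hRR]
  by_cases h1 : (C N * X ^ 2 - C a * X + 1 : F[X]).IsRoot 1
  · -- `a = N + 1`, `R = C N · (X - 1)(X - N⁻¹)`
    have ha : a = N + 1 := by
      simp only [IsRoot.def, eval_add, eval_sub, eval_mul, eval_C, eval_X, eval_pow, one_pow, mul_one,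
        eval_one] at h1
      linear_combination -h1
    have hCC : C N * C N⁻¹ = (1 : F[X]) := by rw [← map_mul, mul_inv_cancel₀ hN, map_one]
    have hfac : (C N * X ^ 2 - C a * X + 1 : F[X]) = C N * ((X - C 1) * (X - C N⁻¹)) := by
      rw [ha, map_add, map_one]
      linear_combination (X - 1) * hCC
    have hne : C N * ((X - C 1) * (X - C N⁻¹)) ≠ (0 : F[X]) :=
      mul_ne_zero (C_ne_zero.mpr hN) (mul_ne_zero (X_sub_C_ne_zero 1) (X_sub_C_ne_zero _))
    have hne' : (X - C 1) * (X - C N⁻¹) ≠ (0 : F[X]) := mul_ne_zero (X_sub_C_ne_zero 1) (X_sub_C_ne_zero _)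
    rw [hfac, rootMultiplicity_mul hne, rootMultiplicity_mul hne, rootMultiplicity_C, rootMultiplicity_C, zero_add,
      zero_add, rootMultiplicity_mul hne', rootMultiplicity_mul hne', rootMultiplicity_X_sub_C_self,
      rootMultiplicity_X_sub_C_self, rootMultiplicity_X_sub_C, rootMultiplicity_X_sub_C]
    by_cases h : N⁻¹ = 1
    · rw [if_pos h.symm, if_pos h]
    · rw [if_neg (Ne.symm h), if_neg h]
  · -- no root at `1`, hence none at `N⁻¹`: `R(N⁻¹) = N⁻¹ · R(1)`
    have h2 : ¬ (C N * X ^ 2 - C a * X + 1 : F[X]).IsRoot N⁻¹ := by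
      intro h2
      apply h1
      simp only [IsRoot.def, eval_add, eval_sub, eval_mul, eval_C, eval_X, eval_pow, one_pow, mul_one,
        eval_one] at h2 ⊢
      have h3 : N * (N⁻¹) ^ 2 - a * N⁻¹ + 1 = N⁻¹ * (N - a + 1) := by
        field_simp
        ring
      rw [h3] at h2
      exact (mul_eq_zero.mp h2).resolve_left (inv_ne_zero hN)
    rw [rootMultiplicity_eq_zero h1, rootMultiplicity_eq_zero h2]

end Roots


/-! ### §L.3 The Σ-Euler factor at one place of `Σ`: first unit coefficient AT `curveLocalLambda κ (E/K) w` -/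

section Place

open Polynomial (C X)

variable {p : ℕ} [Fact p.Prime]

/-- Transport of the tree's Σ-factor lemma (`SigmaFactorFU.firstUnitCoeffAt_aeval_binomialSeries_map`, receptacle
`R₀⟦T⟧`) to a series `P = Q((1+T)^c) ∈ ℤ_p⟦T⟧` with `c = p^n·u`, `u` a unit: `FU(P, p^n · ord_{Y=1} Q̄)`.
[cite: GreenbergVatsal2000, §2 Prop. (2.4) (p. 22)] [cite: Washington1997, §7.1 Prop. 7.2] -/
theorem firstUnitCoeffAt_map_toUnr_of_eq_aeval {c : ℤ_[p]} (n : ℕ) {u : ℤ_[p]} (hu : IsUnit u)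
    (hcu : c = (p : ℤ_[p]) ^ n * u) (Q : Polynomial ℤ_[p]) (hQ : Q.map (PadicInt.toZMod (p := p)) ≠ 0)
    {P : PowerSeries ℤ_[p]} (hP : P = Polynomial.aeval (PowerSeries.binomialSeries ℤ_[p] c) Q) :
    ‖((PowerSeries.coeff (p ^ n * (Q.map (PadicInt.toZMod (p := p))).rootMultiplicity 1)
        (P.map (toUnr p)) : unrIntegers p) : ℂ_[p])‖ = 1 ∧
      ∀ i < p ^ n * (Q.map (PadicInt.toZMod (p := p))).rootMultiplicity 1,
        ‖((PowerSeries.coeff i (P.map (toUnr p)) : unrIntegers p) : ℂ_[p])‖ < 1 := by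
  subst hcu
  subst hP
  rw [SigmaFactorFU.map_aeval_eq]
  exact SigmaFactorFU.firstUnitCoeffAt_aeval_binomialSeries_map Q hQ n hu

/-- **The Σ-Euler factor `P_w` of `E/K` at `w ∈ Σ` (`c_w ≠ 0`) has its first unit coefficient EXACTLY at Keller–Yin's
`curveLocalLambda κ (E/K) w = numPlacesAbove κ w · ord_{X = N(w)⁻¹} P̄_w`** (in `R₀⟦T⟧`). The four reduction types of
`E/K_w`: `P_w = Q_w((1+T)^{c_w})` with `Q_w = N Y² − a_w Y + 1 ∕ N Y − 1 ∕ N Y + 1 ∕ 1` while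
`P̄_w = 1 − ā X + N̄ X² ∕ 1 − X ∕ 1 + X ∕ 1` (`localPolynomialAt_of_*`), and `ord_{Y=1} Q̄_w = ord_{X=N̄⁻¹} P̄_w` (§L.2,
`N̄ ≠ 0` as `w ∤ p`); `numPlacesAbove κ w = p^{v_p(c_w)}` (§L.1). [cite: GreenbergVatsal2000, §2 Prop. (2.4) (p. 22)]
[cite: KellerYin2024, §1.5 (arXiv:2402.12781v2 TeX L1337–1341)] [cite: SilvermanAEC2009, C.§16] -/
theorem firstUnitCoeffAt_eulerFactor_sigmaPlace (W : WeierstrassCurve ℚ) [W.IsElliptic] [W.IsGloballyMinimal]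
    {K : Type} [Field K] [NumberField K] (κ : ZpExtension K p) {w : HeightOneSpectrum (𝓞 K)}
    (hw : w ∈ W.sigmaPlacesFinset p K) (hc : κ.frobExponentAt w ≠ 0) :
    ‖((PowerSeries.coeff (curveLocalLambda κ (W.baseChange K) w)
        ((eulerFactor p ℤ_[p] (Ideal.absNorm w.asIdeal) ((W.baseChange K).localReductionDataAt w)
          (κ.frobExponentAt w)).map (toUnr p)) : unrIntegers p) : ℂ_[p])‖ = 1 ∧
      ∀ i < curveLocalLambda κ (W.baseChange K) w,
        ‖((PowerSeries.coeff i ((eulerFactor p ℤ_[p] (Ideal.absNorm w.asIdeal)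
          ((W.baseChange K).localReductionDataAt w) (κ.frobExponentAt w)).map (toUnr p)) : unrIntegers p) :
            ℂ_[p])‖ < 1 := by
  have hwp : ((p : ℕ) : 𝓞 K) ∉ w.asIdeal := W.forall_mem_sigmaPlacesFinset_not_mem p K w hw
  set c : ℤ_[p] := κ.frobExponentAt w with hcdef
  set N : ℕ := Ideal.absNorm w.asIdeal with hNdef
  -- `N̄ ≠ 0` in `𝔽_p` (`N = ℓ^f`, `ℓ ≠ p`)
  have hN : ((N : ℕ) : ZMod p) ≠ 0 := by
    obtain ⟨ℓ, hℓ, -, hℓp, hℓw⟩ := exists_prime_mem_of_mem_sigmaPlacesFinset W p hw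
    obtain ⟨f, -, hf⟩ := Literature.NumberTheory.GaloisCohomology.exists_residueCard_eq_prime_pow K w hℓ hℓw
    have hNl : N = ℓ ^ f := hf
    rw [hNl, Nat.cast_pow]
    refine pow_ne_zero _ fun h ↦ hℓp ?_
    rw [ZMod.natCast_eq_zero_iff] at h
    exact ((Nat.prime_dvd_prime_iff_eq Fact.out hℓ).mp h).symm
  have hnum : numPlacesAbove κ w = p ^ c.valuation := numPlacesAbove_eq_pow_valuation_frobExponentAt κ hwp hc
  have hcu : c = (p : ℤ_[p]) ^ c.valuation * (PadicInt.unitCoeff hc : ℤ_[p]) := by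
    rw [mul_comm]; exact PadicInt.unitCoeff_spec hc
  have hu : IsUnit (PadicInt.unitCoeff hc : ℤ_[p]) := (PadicInt.unitCoeff hc).isUnit
  have hres : w.residueCard = N := rfl
  rw [curveLocalLambda_eq, hnum]
  unfold GreenbergVatsal2000.eulerFactorModP
  rcases (W.baseChange K).hasGoodReductionAt_or_hasMultiplicativeReductionAt_or_hasAdditiveReductionAt w with
    hg | hm | ha
  · -- good reduction
    set a : ℤ := (W.baseChange K).frobeniusTraceAt w with hadef
    have hQbar : (C (N : ℤ_[p]) * X ^ 2 - C (a : ℤ_[p]) * X + 1 : Polynomial ℤ_[p]).map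
        (PadicInt.toZMod (p := p)) = C ((N : ℕ) : ZMod p) * X ^ 2 - C ((a : ℤ) : ZMod p) * X + 1 := by
      simp only [Polynomial.map_add, Polynomial.map_sub, Polynomial.map_mul, Polynomial.map_pow,
        Polynomial.map_X, Polynomial.map_one, map_natCast, map_intCast, Polynomial.map_natCast,
        Polynomial.map_intCast]
    have hPbar : (1 - C a * X + C ((w.residueCard : ℕ) : ℤ) * X ^ 2 : Polynomial ℤ).map
        (Int.castRingHom (ZMod p)) = 1 - C ((a : ℤ) : ZMod p) * X + C ((N : ℕ) : ZMod p) * X ^ 2 := by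
      simp only [Polynomial.map_add, Polynomial.map_sub, Polynomial.map_mul, Polynomial.map_pow,
        Polynomial.map_X, Polynomial.map_one, eq_intCast, hres,
        Polynomial.map_natCast, Polynomial.map_intCast, map_natCast, map_intCast]
    have hQ0 : (C (N : ℤ_[p]) * X ^ 2 - C (a : ℤ_[p]) * X + 1 : Polynomial ℤ_[p]).map
        (PadicInt.toZMod (p := p)) ≠ 0 := by
      rw [hQbar]
      refine fun h ↦ one_ne_zero (α := ZMod p) ?_
      have h0 := congrArg (fun P : Polynomial (ZMod p) ↦ P.coeff 0) h
      simp at h0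
    rw [(W.baseChange K).localReductionDataAt_of_hasGoodReductionAt w hg,
      localPolynomialAt_of_hasGoodReductionAt hg, natCard_residueField_eq_residueCard, hPbar,
      ← rootMultiplicity_good _ hN, ← hQbar]
    refine firstUnitCoeffAt_map_toUnr_of_eq_aeval c.valuation hu hcu _ hQ0 ?_
    simp only [eulerFactor, val_onePlusTPow, map_add, map_sub, map_mul, map_pow, map_one,
      Polynomial.aeval_X, map_natCast, map_intCast]
    rfl
  · by_cases hs : (W.baseChange K).HasSplitMultiplicativeReductionAt w
    · -- split multiplicative
      have hQbar : (C (N : ℤ_[p]) * X - 1 : Polynomial ℤ_[p]).map (PadicInt.toZMod (p := p)) =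
          C ((N : ℕ) : ZMod p) * X - 1 := by
        simp only [Polynomial.map_sub, Polynomial.map_mul, Polynomial.map_X, Polynomial.map_one,
          map_natCast, Polynomial.map_natCast]
      have hPbar : (1 - X : Polynomial ℤ).map (Int.castRingHom (ZMod p)) = 1 - X := by
        simp only [Polynomial.map_sub, Polynomial.map_X, Polynomial.map_one]
      have hQ0 : (C (N : ℤ_[p]) * X - 1 : Polynomial ℤ_[p]).map (PadicInt.toZMod (p := p)) ≠ 0 := by
        rw [hQbar]
        refine fun h ↦ one_ne_zero (α := ZMod p) ?_
        have h0 := congrArg (fun P : Polynomial (ZMod p) ↦ P.coeff 0) h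
        simp at h0
      rw [(W.baseChange K).localReductionDataAt_of_hasSplitMultiplicativeReductionAt w hs,
        localPolynomialAt_of_hasSplitMultiplicativeReductionAt hs, hPbar, ← rootMultiplicity_split, ← hQbar]
      refine firstUnitCoeffAt_map_toUnr_of_eq_aeval c.valuation hu hcu _ hQ0 ?_
      simp only [eulerFactor, val_onePlusTPow, map_sub, map_mul, map_one, Polynomial.aeval_X,
        map_natCast]
    · -- non-split multiplicative
      have hQbar : (C (N : ℤ_[p]) * X + 1 : Polynomial ℤ_[p]).map (PadicInt.toZMod (p := p)) =
          C ((N : ℕ) : ZMod p) * X + 1 := by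
        simp only [Polynomial.map_add, Polynomial.map_mul, Polynomial.map_X, Polynomial.map_one,
          map_natCast, Polynomial.map_natCast]
      have hPbar : (1 + X : Polynomial ℤ).map (Int.castRingHom (ZMod p)) = 1 + X := by
        simp only [Polynomial.map_add, Polynomial.map_X, Polynomial.map_one]
      have hQ0 : (C (N : ℤ_[p]) * X + 1 : Polynomial ℤ_[p]).map (PadicInt.toZMod (p := p)) ≠ 0 := by
        rw [hQbar]
        refine fun h ↦ one_ne_zero (α := ZMod p) ?_
        have h0 := congrArg (fun P : Polynomial (ZMod p) ↦ P.coeff 0) h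
        simp at h0
      rw [(W.baseChange K).localReductionDataAt_of_not_hasSplitMultiplicativeReductionAt w hm hs,
        localPolynomialAt_of_hasMultiplicativeReductionAt_of_not_hasSplitMultiplicativeReductionAt hm hs, hPbar,
        ← rootMultiplicity_nonsplit, ← hQbar]
      refine firstUnitCoeffAt_map_toUnr_of_eq_aeval c.valuation hu hcu _ hQ0 ?_
      simp only [eulerFactor, val_onePlusTPow, map_add, map_mul, map_one, Polynomial.aeval_X,
        map_natCast]
  · -- additive: `P_w = 1`, index `0`
    have h0 : ((1 : Polynomial ℤ).map (Int.castRingHom (ZMod p))).rootMultiplicity (((N : ℕ) : ZMod p)⁻¹) = 0 := by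
      rw [Polynomial.map_one]
      exact Polynomial.rootMultiplicity_eq_zero (by simp)
    rw [(W.baseChange K).localReductionDataAt_of_hasAdditiveReductionAt w ha,
      localPolynomialAt_of_hasAdditiveReductionAt ha, h0, mul_zero]
    simp only [eulerFactor, map_one]
    exact SigmaFactorFU.firstUnitCoeffAt_one

end Place

end Summit.BirchSwinnertonDyer.BirchSwinnertonDyer.Theorems.CrystalLambdaSigma

end
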